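import Summits.ABC.IUTFork.Thm311RealIsmDHMoverCriterion
import Summits.ABC.IUTFork.Thm311RealLog
import Mathlib.Analysis.Normed.Module.Ball.Pointwise
import HarnessLib

/-!
# [IUTchIII] Cor. 3.12 support — the (Ind2) MOVER-TO-THE-TOP at a TAME SHALLOW place: for `p⁻¹ < ‖t‖ ≤ 1`
# some element of `Real.ismDH` carries the sub-ball `t·I_v` of the log-shell onto a set reaching the top of `I_v`

PROOF-ONLY file (0 definitions, 0 named `Prop` facts) of the abc-iut cell (WAVE-5 prover seat abc-iut-w5-d060,
gen 6; support piece «LICENCE-SHALLOW-LOCAL», the ONE-FACTOR input of abc-iut-c312-3's hand proof «the (xi-f)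
licence HOLDS at shallow, tamely ramified data» (HOME/STATUS 2026-08-26T08:51:10Z) and of abc-iut-w4-d094's
regime (B) «hull LOWER bound via explicit lattice movers» (08:41:43Z)). TAKES NO SIDE on [IUTchIII] Cor. 3.12.

SETTING.  `F` a number field, `v | p` a finite place over an ODD prime `p` with `e := e(v|p) ≤ p − 2` (any residue
degree), `K_v` = abc-iut-S7's `RescaledCompletion F p v` (`‖p‖ = p⁻¹`, `‖ϖ‖ = p^{−1/e}` for a norm uniformizer `ϖ`),
`logv` the analytic logarithm over `p` (`LogvAnalyticAt`, e.g. `Real.analyticLogv`), `I_v = shell logv (inr v)` =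
`(p^*)⁻¹·log_p(𝒪_v^×)` abc-iut-c312-5's log-shell ([IUTchIII] Def. 1.1 (i)), `Real.ismDH logv (inr v)` its (Ind2)
slot = the bicontinuous `ℚ`-linear automorphisms of `K_v` fixing `I_v` (Dupuy–Hilado §4.9 «`ℚ_p`-vector space
automorphisms which arise as `ℤ_p`-lattice isomorphisms of `I_v`»; = `Aut_{ℚ_p}(K_v : log_p(𝒪_v^×))` by
abc-iut-w5-d180's dictionary `exists_mem_ismDH_of_mem_latticeAut` / `exists_mem_latticeAut_of_mem_ismDH`).

RESULTS (classical lattice algebra; nothing new about [IUTchIII] §3):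
* §1 `ofR_mem_shell_iff_norm_le_of_tame` / `setOf_ofR_mem_shell_eq_closedBall_of_tame`: at such a place
  **`I_v = {‖y‖ ≤ p·‖ϖ‖} = 𝔪_v^{1−e} = p⁻¹·𝔪_v`** (campaign-S `prop12iEq_holds` through w5-d180's
  `logUnits_eq_closedBall_of_tame`: `log_p(𝒪_v^×) = 𝔪_v`, and `p^* = p`); `prime_mul_norm_eq_norm_zpow`: `p·‖ϖ‖ =
  ‖ϖ‖^{1−e}`.  (General-`e` form of abc-iut-w5-d216's `shell_analyticLogv_eq_image_closedBall` (`e = 2`).)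
* §2 **`exists_mem_ismDH_map_eq_top_of_tame`** — for every `t ∈ K_v` with **`p⁻¹ < ‖t‖ ≤ 1`** (`0 ≤ ord_v(t) < e`)
  there is `g ∈ Real.ismDH logv (inr v)` with `g(t·p⁻¹ϖ) = p⁻¹ϖ`: the vectors `t·ϖ` and `ϖ` are PRIMITIVE in the
  lattice `log_p(𝒪_v^×) = 𝔪_v` (norm `> p⁻¹·‖ϖ‖`), and `Aut_{ℚ_p}(K_v : Λ)` is transitive on primitive vectors
  (campaign-S `PadicModule.exists_latticeAut_map_eq`, Weil *BNT* II §2 Th. 1).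
* §3 **`exists_mem_ismDH_image_smul_shell_of_tame`** — hence `g '' (t·I_v) ⊆ I_v` CONTAINS the element `p⁻¹ϖ` of
  MAXIMAL norm `p·‖ϖ‖` of `I_v`, and (`hull` clause) every ball `{‖y‖ ≤ ‖μ‖} = μ·𝒪_v` — the one-factor hull-sets of
  [IUTchIII] Rmk. 3.9.5 (i) — containing `g '' (t·I_v)` contains ALL of `I_v`: the one-factor holomorphic hull of the
  moved sub-ball `t·I_v = {‖y‖ ≤ ‖t‖·p·‖ϖ‖}` (itself a ball, of smaller radius when `‖t‖ < 1`) jumps to `I_v`.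
  `…_analyticLogv`: the same for `Real.analyticLogv F` at `p = p_v`.

USE (not done here).  This is the per-place input «some `φ_v ∈ ismDH(v)` has `λ₀ ∈ φ_v(t_{Θ,j,v}·I_v)`, `λ₀` of minimal
valuation in `I_v`» of the hand argument that at the sharp real settings `settingDHVolSharp`/`settingPrVolSharp` the
hull of the (Ind1)/(Ind2)-images of the Θ-box `ι_j(t_{Θ,j,v})·(R_I)^∼` at a `(j+1)`-tuple with bad last slot `v` is the
full `(R_I)^∼ ⊇ ι_j(t_{q,v})·(R_I)^∼` whenever `‖t_{Θ,j,v}‖ > p⁻¹` at a tame `v` — the `(j+1)`-fold tensor transport to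
the Summits-side frames is the consumer's. Negative complements already in tree: at `e(v|p) = 1` (odd `p`) NO ball is
moved (w5-d180 `forall_ismDH_image_closedBall_eq_of_unramified`); at DEEP packets the licence fails (abc-iut-w4-d026
`not_licence_settingDHVolSharp_of_deep`).  HONEST FRAMING: statements about OUR typed (Ind2) slot `Real.ismDH` (the
Dupuy–Hilado reading) acting on one-factor balls; which reading of [IUTchIII] Thm. 3.11 (i) (Ind2) is print's, and
anything about Cor. 3.12, is for the referee lanes.  [cite: DupuyHilado2025, §4.9] [cite: WeilBNT1967, Ch. II §2, Th. 1–2]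
[cite: NeukirchANT1999, Ch. II Prop. (5.5)] [claim: Mochizuki2012, status: disputed] for every [IUTchIII] locution.
Consumed BY NAME, nothing restated: `Real.ismDH`, `toR`/`ofR`, `mem_shell_iff_mem_smul_logUnits`, `LogvAnalyticAt`,
`logvAnalyticAt_analyticLogv` (c312-5), `RescaledCompletion`, `absRamificationIdx_rescaledCompletion`,
`exists_isUniformizer_rescaledCompletion` (S7), `norm_prime`, `norm_pow_absRamificationIdx`, `PadicModule.*` (campaign S),
`exists_basis_coe_logUnits_eq`, `logUnits_eq_closedBall_of_tame`, `exists_mem_ismDH_of_mem_latticeAut` (w5-d180).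
typed ≠ proved; no side taken on [IUTchIII] Cor. 3.12.
-/

noncomputable section

open Set Metric NumberField IsDedekindDomain
open scoped Pointwise

namespace Summit.ABC.IUTFork.Thm311.Real

open Cor312Vol Literature.IUT.LogThetaLattice Literature.IUT.LogVolume Literature.NumberTheory.NumberFields
open Literature.NumberTheory.GaloisRepresentations.Ultrametric

variable {F : Type} [Field F] [NumberField F] {p : ℕ} [hp : Fact p.Prime]
variable {logv : PadicLogs F} (hlog : LogvAnalyticAt p logv)
variable {v : HeightOneSpectrum (𝓞 F)} {hv : ((p : ℕ) : 𝓞 F) ∈ v.asIdeal}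

/-! ## 1. At a tame place the log-shell is the ball `{‖y‖ ≤ p·‖ϖ‖} = 𝔪_v^{1−e}` -/

/-- `p·‖ϖ‖ = ‖ϖ‖^{1−e(v|p)}` for a norm uniformizer `ϖ` of the rescaled completion (`‖ϖ‖^e = p⁻¹`).
[cite: NeukirchANT1999, Ch. II Prop. (6.8)] -/
theorem prime_mul_norm_eq_norm_zpow {ϖ : (RescaledCompletion F p v hv)ˣ}
    (hϖ : IsUniformizer ϖ) :
    (p : ℝ) * ‖(ϖ : RescaledCompletion F p v hv)‖ =
      ‖(ϖ : RescaledCompletion F p v hv)‖ ^ (1 - (v.asIdeal.ramificationIdx ℤ : ℤ)) := by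
  have hE := norm_pow_absRamificationIdx p (RescaledCompletion F p v hv) hϖ
  rw [absRamificationIdx_rescaledCompletion F p v hv] at hE
  have hn0 : ‖(ϖ : RescaledCompletion F p v hv)‖ ≠ 0 := norm_ne_zero_iff.2 ϖ.ne_zero
  rw [zpow_sub₀ hn0, zpow_one, zpow_natCast, hE, div_inv_eq_mul, mul_comm]

include hlog in
/-- **Tame places: `y ∈ I_v ↔ ‖y‖ ≤ p·‖ϖ‖`.** For `p > 2`, `e(v|p) ≤ p − 2` and the analytic logarithm, membership in
abc-iut-c312-5's log-shell `Real.shell logv (inr v) = (p^*)⁻¹·log_v(𝒪_v^×)` ([IUTchIII] Def. 1.1 (i)), read in the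
rescaled completion, is `‖y‖ ≤ p·‖ϖ‖` (`p^* = p`, `log_p(𝒪_v^×) = 𝔪_v = {‖y‖ ≤ ‖ϖ‖}` by [IUTchIV] Prop. 1.2 (i),
equality clause; `‖p⁻¹‖ = p`). [cite: NeukirchANT1999, Ch. II Prop. (5.5)] [claim: Mochizuki2012, status: disputed] -/
theorem ofR_mem_shell_iff_norm_le_of_tame (hp2 : 2 < p) (he : v.asIdeal.ramificationIdx ℤ ≤ p - 2)
    {ϖ : (RescaledCompletion F p v hv)ˣ} (hϖ : IsUniformizer ϖ) (a : RescaledCompletion F p v hv) :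
    ofR p v hv a ∈ shell logv (.inr v) ↔ ‖a‖ ≤ (p : ℝ) * ‖(ϖ : RescaledCompletion F p v hv)‖ := by
  have hodd : Odd p := hp.out.odd_of_ne_two (by omega)
  rw [mem_shell_iff_mem_smul_logUnits v hv hlog a, pStar_of_odd hodd, logUnits_eq_closedBall_of_tame hp2 he hϖ,
    smul_closedBall _ _ (norm_nonneg _), smul_zero, mem_closedBall_zero_iff, norm_inv, Padic.norm_p, inv_inv]

include hlog in
/-- **Tame places: `I_v = {‖y‖ ≤ p·‖ϖ‖} = p⁻¹·𝔪_v = 𝔪_v^{1−e}`** (set form of `ofR_mem_shell_iff_norm_le_of_tame`; the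
general-`e` version of abc-iut-w5-d216's `shell_analyticLogv_eq_image_closedBall`, `e = 2`).
[cite: NeukirchANT1999, Ch. II Prop. (5.5)] [claim: Mochizuki2012, status: disputed] -/
theorem setOf_ofR_mem_shell_eq_closedBall_of_tame (hp2 : 2 < p) (he : v.asIdeal.ramificationIdx ℤ ≤ p - 2)
    {ϖ : (RescaledCompletion F p v hv)ˣ} (hϖ : IsUniformizer ϖ) :
    {a : RescaledCompletion F p v hv | ofR p v hv a ∈ shell logv (.inr v)} =
      closedBall (0 : RescaledCompletion F p v hv) ((p : ℝ) * ‖(ϖ : RescaledCompletion F p v hv)‖) :=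
  Set.ext fun a => by
    rw [mem_setOf_eq, ofR_mem_shell_iff_norm_le_of_tame hlog hp2 he hϖ a, mem_closedBall_zero_iff]

/-! ## 2. The mover to the top -/

include hlog in
/-- **MOVER TO THE TOP (element form).** At a place `v | p`, `p > 2`, `e(v|p) ≤ p − 2`, with the analytic logarithm:
for every `t ∈ K_v` with `p⁻¹ < ‖t‖ ≤ 1` (i.e. `0 ≤ ord_v(t) < e(v|p)`) there is an element `g` of Dupuy–Hilado's
(Ind2) group `Real.ismDH logv (inr v)` with **`g(t·p⁻¹ϖ) = p⁻¹ϖ`** — it carries the element `t·p⁻¹ϖ` of the sub-ball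
`t·I_v` to an element of MAXIMAL norm `p·‖ϖ‖` of `I_v`. Proof: `t·ϖ` and `ϖ` lie in `Λ := log_p(𝒪_v^×) = 𝔪_v` but not
in `p·Λ` (norms `> p⁻¹·‖ϖ‖`), i.e. both are PRIMITIVE; `Aut_{ℚ_p}(K_v : Λ)` acts transitively on primitive vectors (Weil
*BNT* II §2 Th. 1: `PadicModule.exists_latticeAut_map_eq`), and lattice automorphisms are (Ind2)-elements (w5-d180's
dictionary); `ℚ_p`-linearity moves the factor `p⁻¹` across. [cite: DupuyHilado2025, §4.9]
[cite: WeilBNT1967, Ch. II §2, Th. 1] [claim: Mochizuki2012, status: disputed] -/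
theorem exists_mem_ismDH_map_eq_top_of_tame (hp2 : 2 < p) (he : v.asIdeal.ramificationIdx ℤ ≤ p - 2)
    {ϖ : (RescaledCompletion F p v hv)ˣ} (hϖ : IsUniformizer ϖ) {t : RescaledCompletion F p v hv}
    (htp : (p : ℝ)⁻¹ < ‖t‖) (ht1 : ‖t‖ ≤ 1) :
    ∃ g ∈ ismDH logv (.inr v),
      toR p v hv (g (ofR p v hv (t * ((p : RescaledCompletion F p v hv)⁻¹ * ϖ)))) =
        (p : RescaledCompletion F p v hv)⁻¹ * ϖ := by
  obtain ⟨n, hn, B, hΛ⟩ := exists_basis_coe_logUnits_eq (p := p) v hv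
  have hball : (PadicModule.basisLattice p B : Set (RescaledCompletion F p v hv)) = closedBall 0 ‖(ϖ : RescaledCompletion F p v hv)‖ := by
    rw [← hΛ, logUnits_eq_closedBall_of_tame hp2 he hϖ]
  have hmemΛ : ∀ x : RescaledCompletion F p v hv, x ∈ PadicModule.basisLattice p B ↔ ‖x‖ ≤ ‖(ϖ : RescaledCompletion F p v hv)‖ := fun x => by
    rw [← SetLike.mem_coe, hball, mem_closedBall_zero_iff]
  have hpos : (0 : ℝ) < p := by exact_mod_cast hp.out.pos
  have hϖpos : 0 < ‖(ϖ : RescaledCompletion F p v hv)‖ := norm_pos_iff.2 ϖ.ne_zero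
  -- a vector of `Λ = {‖x‖ ≤ ‖ϖ‖}` of norm `> p⁻¹·‖ϖ‖` is primitive (`∉ p·Λ`)
  have hprim : ∀ x : RescaledCompletion F p v hv, (p : ℝ)⁻¹ * ‖(ϖ : RescaledCompletion F p v hv)‖ < ‖x‖ → ‖x‖ ≤ ‖(ϖ : RescaledCompletion F p v hv)‖ →
      x ∈ PadicModule.basisLattice p B ∧ ∃ i, ‖B.repr x i‖ = 1 := by
    intro x hlt hle
    have hx : x ∈ PadicModule.basisLattice p B := (hmemΛ x).2 hle
    refine ⟨hx, (PadicModule.primitive_iff_not_mem_p_smul p B hx).2 ?_⟩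
    rintro ⟨y, hy, rfl⟩
    have hy' : ‖y‖ ≤ ‖(ϖ : RescaledCompletion F p v hv)‖ := (hmemΛ y).1 hy
    have hle' : ‖(p : ℚ_[p]) • y‖ ≤ (p : ℝ)⁻¹ * ‖(ϖ : RescaledCompletion F p v hv)‖ := by
      rw [norm_smul, Padic.norm_p]
      exact mul_le_mul_of_nonneg_left hy' (by positivity)
    exact (not_lt.2 hle') hlt
  obtain ⟨hx1, i, hi⟩ := hprim (t * ϖ) (by rw [norm_mul]; exact mul_lt_mul_of_pos_right htp hϖpos)
    (by rw [norm_mul]; exact mul_le_of_le_one_left hϖpos.le ht1)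
  obtain ⟨hy1, j, hj⟩ := hprim (ϖ : RescaledCompletion F p v hv)
    (mul_lt_of_lt_one_left hϖpos (inv_lt_one_of_one_lt₀ (by exact_mod_cast hp.out.one_lt))) le_rfl
  obtain ⟨φ, hφ, hφx⟩ := PadicModule.exists_latticeAut_map_eq p B hx1 hy1 hi hj
  obtain ⟨g, hg, hgφ⟩ := exists_mem_ismDH_of_mem_latticeAut hlog B hΛ hφ
  refine ⟨g, hg, ?_⟩
  have hsm : t * ((p : RescaledCompletion F p v hv)⁻¹ * ϖ) = (p : ℚ_[p])⁻¹ • (t * ϖ) := by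
    rw [Algebra.smul_def, map_inv₀, map_natCast]; ring
  rw [hgφ, hsm, LinearEquiv.map_smul, hφx, Algebra.smul_def, map_inv₀, map_natCast]

/-! ## 3. Image form: `g '' (t·I_v) ⊆ I_v` reaches the top of `I_v`; its one-factor hull is `I_v` -/

include hlog in
/-- **MOVER TO THE TOP (image form) with the one-factor HULL clause.** At `v | p`, `p > 2`, `e(v|p) ≤ p − 2`, analytic
logarithm, for `p⁻¹ < ‖t‖ ≤ 1`: some `g ∈ Real.ismDH logv (inr v)` maps the sub-ball `t·I_v = {‖y‖ ≤ ‖t‖·p·‖ϖ‖}` of the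
log-shell `I_v = {‖y‖ ≤ p·‖ϖ‖}` (i) INTO `I_v` (it fixes `I_v`), (ii) onto a set CONTAINING `p⁻¹ϖ`, (iii) an element of
the maximal norm `p·‖ϖ‖` of `I_v`; (iv) consequently every ball `{‖y‖ ≤ ‖μ‖} = μ·𝒪_v` (the one-factor hull-sets,
[IUTchIII] Rmk. 3.9.5 (i)) containing `g '' (t·I_v)` contains `I_v` — the one-factor holomorphic hull of the moved
sub-ball is the WHOLE log-shell, although `t·I_v` itself is a ball of radius `‖t‖·p·‖ϖ‖ < p·‖ϖ‖` when `‖t‖ < 1`.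
[cite: DupuyHilado2025, §4.9] [cite: WeilBNT1967, Ch. II §2, Th. 1] [claim: Mochizuki2012, status: disputed] -/
theorem exists_mem_ismDH_image_smul_shell_of_tame (hp2 : 2 < p) (he : v.asIdeal.ramificationIdx ℤ ≤ p - 2)
    {ϖ : (RescaledCompletion F p v hv)ˣ} (hϖ : IsUniformizer ϖ) {t : RescaledCompletion F p v hv}
    (htp : (p : ℝ)⁻¹ < ‖t‖) (ht1 : ‖t‖ ≤ 1) :
    ∃ g ∈ ismDH logv (.inr v),
      (fun a => toR p v hv (g (ofR p v hv a))) ''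
            closedBall (0 : RescaledCompletion F p v hv) (‖t‖ * ((p : ℝ) * ‖(ϖ : RescaledCompletion F p v hv)‖)) ⊆
          closedBall 0 ((p : ℝ) * ‖(ϖ : RescaledCompletion F p v hv)‖) ∧
      (p : RescaledCompletion F p v hv)⁻¹ * ϖ ∈ (fun a => toR p v hv (g (ofR p v hv a))) ''
          closedBall (0 : RescaledCompletion F p v hv) (‖t‖ * ((p : ℝ) * ‖(ϖ : RescaledCompletion F p v hv)‖)) ∧
      ‖(p : RescaledCompletion F p v hv)⁻¹ * (ϖ : RescaledCompletion F p v hv)‖ =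
          (p : ℝ) * ‖(ϖ : RescaledCompletion F p v hv)‖ ∧
      ∀ μ : RescaledCompletion F p v hv,
        (fun a => toR p v hv (g (ofR p v hv a))) ''
              closedBall (0 : RescaledCompletion F p v hv) (‖t‖ * ((p : ℝ) * ‖(ϖ : RescaledCompletion F p v hv)‖)) ⊆
            closedBall 0 ‖μ‖ →
          closedBall (0 : RescaledCompletion F p v hv) ((p : ℝ) * ‖(ϖ : RescaledCompletion F p v hv)‖) ⊆
            closedBall 0 ‖μ‖ := by
  obtain ⟨g, hg, hgt⟩ := exists_mem_ismDH_map_eq_top_of_tame hlog hp2 he hϖ htp ht1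
  have hpos : (0 : ℝ) < p := by exact_mod_cast hp.out.pos
  have hnorm : ‖(p : RescaledCompletion F p v hv)⁻¹ * (ϖ : RescaledCompletion F p v hv)‖ = (p : ℝ) * ‖(ϖ : RescaledCompletion F p v hv)‖ := by
    rw [norm_mul, norm_inv, norm_prime, inv_inv]
  have htop : (p : RescaledCompletion F p v hv)⁻¹ * ϖ ∈ (fun a => toR p v hv (g (ofR p v hv a))) ''
      closedBall (0 : RescaledCompletion F p v hv) (‖t‖ * ((p : ℝ) * ‖(ϖ : RescaledCompletion F p v hv)‖)) :=
    ⟨t * ((p : RescaledCompletion F p v hv)⁻¹ * ϖ), by rw [mem_closedBall_zero_iff, norm_mul, hnorm], hgt⟩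
  refine ⟨g, hg, ?_, htop, hnorm, fun μ hμ => ?_⟩
  · rintro _ ⟨a, ha, rfl⟩
    rw [mem_closedBall_zero_iff] at ha ⊢
    have ha' : ‖a‖ ≤ (p : ℝ) * ‖(ϖ : RescaledCompletion F p v hv)‖ := ha.trans (mul_le_of_le_one_left (by positivity) ht1)
    have hmem : ofR p v hv a ∈ shell logv (.inr v) := (ofR_mem_shell_iff_norm_le_of_tame hlog hp2 he hϖ a).2 ha'
    obtain ⟨-, -, hgshell⟩ := hg
    have h' : g (ofR p v hv a) ∈ (g : Carrier (.inr v : Place F) → Carrier (.inr v : Place F)) ''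
        shell logv (.inr v) := ⟨_, hmem, rfl⟩
    rw [hgshell] at h'
    exact (ofR_mem_shell_iff_norm_le_of_tame hlog hp2 he hϖ _).1 h'
  · have h := mem_closedBall_zero_iff.1 (hμ htop)
    rw [hnorm] at h
    exact closedBall_subset_closedBall h

/-! ## 4. The analytic instance -/

/-- **The same for the ANALYTIC family `Real.analyticLogv`** at a place of residue characteristic `p > 2` with
`e(v|p) ≤ p − 2`: for `p⁻¹ < ‖t‖ ≤ 1` some `g ∈ Real.ismDH (analyticLogv F) (inr v)` has `g(t·p⁻¹ϖ) = p⁻¹ϖ`, an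
element of maximal norm of the log-shell `I_v = {‖y‖ ≤ p·‖ϖ‖}` (c312-5 `logvAnalyticAt_analyticLogv`).
[cite: DupuyHilado2025, §4.9] [cite: WeilBNT1967, Ch. II §2, Th. 1] [claim: Mochizuki2012, status: disputed] -/
theorem exists_mem_ismDH_map_eq_top_analyticLogv (hp2 : 2 < p) (he : v.asIdeal.ramificationIdx ℤ ≤ p - 2)
    {ϖ : (RescaledCompletion F p v hv)ˣ} (hϖ : IsUniformizer ϖ) {t : RescaledCompletion F p v hv}
    (htp : (p : ℝ)⁻¹ < ‖t‖) (ht1 : ‖t‖ ≤ 1) :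
    ∃ g ∈ ismDH (analyticLogv F) (.inr v),
      toR p v hv (g (ofR p v hv (t * ((p : RescaledCompletion F p v hv)⁻¹ * ϖ)))) =
          (p : RescaledCompletion F p v hv)⁻¹ * ϖ ∧
        ∀ a : RescaledCompletion F p v hv,
          ofR p v hv a ∈ shell (analyticLogv F) (.inr v) ↔ ‖a‖ ≤ (p : ℝ) * ‖(ϖ : RescaledCompletion F p v hv)‖ := by
  obtain ⟨g, hg, hgt⟩ :=
    exists_mem_ismDH_map_eq_top_of_tame (logvAnalyticAt_analyticLogv (F := F) p) hp2 he hϖ htp ht1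
  exact ⟨g, hg, hgt, fun a => ofR_mem_shell_iff_norm_le_of_tame (logvAnalyticAt_analyticLogv (F := F) p) hp2 he hϖ a⟩

end Summit.ABC.IUTFork.Thm311.Real

end
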